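import Summits.BirchSwinnertonDyer.BirchSwinnertonDyer.Theorems.BiquadraticEisensteinDescentDeuringCoreRow
import Literature.NumberTheory.EllipticCurves.QuadraticTwistJInvariantProofs
import Literature.NumberTheory.EllipticCurves.IsogenyVariableChangeProofs
import Literature.NumberTheory.EllipticCurves.GlobalMinimalModelProofs
import Literature.NumberTheory.DiophantineGeometry.LocalReductionProofs
import HarnessLib

set_option linter.dupNamespace false -- `Summit.BirchSwinnertonDyer.BirchSwinnertonDyer.Theorems.…` (summit = sub)
set_option autoImplicit false

/-!
# BED route, «Deuring-ψ lane»: the row `j = 8000` (`K = ℚ(√−2)`, `d_K = −8`) of the Deuring CORE from TWO base curves `E`, `E^{(−1)}`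

Route `BiquadraticEisensteinDescent` of `Summits/BirchSwinnertonDyer` (crux `EisensteinHeartFlatCMInertBadKPrime`, stmt-BirchSwinnertonDyer-21341;
cell `bsd-wall`, seat w4 g17). THEOREMS ONLY. Sequel of `…DeuringCoreRow` (rows with odd CM prime `ℓ`). Here the CM prime is `2`, which is
RAMIFIED in every twist field of even discriminant, so the twist layer `core_quadraticTwist_of_core` only reaches the twists by `D ≡ 1 (mod 4)`;
the twists by `d ≡ 3 (mod 4)` are reached from the second base curve `E^{(−1)}` (`E^{(d)} = (E^{(−1)})^{(−d)}`), and the even twists through the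
CM isogeny `E ∼ E^{(−8)} ≅ E^{(−2)}` (`E^{(2m)} = (E^{(−2)})^{(−m)} ∼ E^{(−m)}`).

* `core_quadraticTwist_of_core'` — the twist layer WITHOUT the global-minimality hypothesis on the base (`quadraticTwist_smul`, `LSeries_smul`).
* **`core_of_j_eq_of_core_pair_two`** — CORE(`E`) ∧ CORE(`E^{(−1)}`) ⇒ CORE(`W`) for every elliptic `W/ℚ` with `W.j = E.j`, when
  `cmFieldDiscr E.j = −8` and `E`, `E^{(−1)}` have good reduction away from `2`.

BSD is not proved by any of this. References: [SilvermanAEC2009] X.2 Ex. 10.16, X.5 Cor. 5.4.1; [SilvermanATAEC1994] II Thm. 10.5 (b);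
[Knapp1992] Thm. 11.67.
-/

noncomputable section

open scoped Classical NumberField
open NumberField IsDedekindDomain WeierstrassCurve Rat.HeightOneSpectrum
  Literature.NumberTheory.GaloisRepresentations
  Literature.NumberTheory.EllipticCurves
open Literature.Barriers.RiemannHypothesis (IsFundamentalDiscriminant)

namespace Summit.BirchSwinnertonDyer.BirchSwinnertonDyer.Theorems.BiquadraticEisensteinDescentDeuringOfCore

variable {K : Type} [Field K] [NumberField K]

/-! ## §1 The twist layer without global minimality -/

/-- **`core_quadraticTwist_of_core` for an arbitrary model**: the core passes from ANY elliptic model `E` to `E^{(D)}` (global minimal model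
`C • E`, `(C • E)^{(D)} = (u, Dr, 0, 0) • E^{(D)}`, `L` is an isomorphism invariant). [cite: SilvermanAEC2009, X.2 Exercise 10.16 and X.5 Cor. 5.4.1] -/
theorem core_quadraticTwist_of_core' (E : WeierstrassCurve ℚ) [E.IsElliptic] (hj : E.j ∈ maximalCMJInvariants) (hK : IsCMFieldOfJ K E.j)
    (hcore : ∃ ψ : HeckeCharacter K, ψ.HasInfinityType (fun _ ↦ 1) (fun _ ↦ 0) ∧
      ∀ s : ℂ, 3 / 2 < s.re → heckeLFunction ψ s = E.LSeries s)
    {D : ℤ} (hD : IsFundamentalDiscriminant D)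
    (hgoodD : ∀ (p : ℕ) [Fact p.Prime], (p : ℤ) ∣ D → E.HasGoodReductionAtPrime p)
    [(E.quadraticTwist (D : ℚ)).IsElliptic] :
    ∃ ψ : HeckeCharacter K, ψ.HasInfinityType (fun _ ↦ 1) (fun _ ↦ 0) ∧
      ∀ s : ℂ, 3 / 2 < s.re → heckeLFunction ψ s = (E.quadraticTwist (D : ℚ)).LSeries s := by
  have hD0 : (D : ℚ) ≠ 0 := by
    have : D ≠ 0 := by
      rintro rfl
      rcases hD with ⟨h1, -, -⟩ | ⟨-, -, hsq⟩
      · norm_num at h1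
      · simp at hsq
    exact_mod_cast this
  obtain ⟨C, hC⟩ := hasGlobalMinimalModel_rat_holds E
  haveI := hC
  haveI : ((C • E).quadraticTwist (D : ℚ)).IsElliptic := (C • E).isElliptic_quadraticTwist hD0
  have hjm : (C • E).j = E.j := variableChange_j E C
  have hcorem : ∃ ψ : HeckeCharacter K, ψ.HasInfinityType (fun _ ↦ 1) (fun _ ↦ 0) ∧
      ∀ s : ℂ, 3 / 2 < s.re → heckeLFunction ψ s = (C • E).LSeries s :=
    core_of_LSeries_eq (WeierstrassCurve.LSeries_smul E C) hcore
  have hgoodm : ∀ (p : ℕ) [Fact p.Prime], (p : ℤ) ∣ D → (C • E).HasGoodReductionAtPrime p := by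
    intro p hp hpD
    obtain ⟨v, rfl⟩ : ∃ v : HeightOneSpectrum (𝓞 ℚ), (primesEquiv v : ℕ) = p :=
      ⟨primesEquiv.symm ⟨p, hp.out⟩, by rw [Equiv.apply_symm_apply]⟩
    exact (hasGoodReductionAtPrime_iff_hasGoodReductionAt_ringOfIntegers v (C • E)).mpr
      ((hasGoodReductionAt_smul_iff_holds v E C).mpr ((hasGoodReductionAtPrime_iff_hasGoodReductionAt_ringOfIntegers v E).mp (hgoodD _ hpD)))
  have h := core_quadraticTwist_of_core (C • E) (by rw [hjm]; exact hj) (by rw [hjm]; exact hK) hcorem hD hgoodm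
  refine core_of_LSeries_eq ?_ h
  rw [quadraticTwist_smul, WeierstrassCurve.LSeries_smul]

/-! ## §2 The row `d_K = −8` from the pair `E`, `E^{(−1)}` -/

section Two

variable (E : WeierstrassCurve ℚ) [E.IsElliptic]

/-- **Odd square-free twists**: CORE for `E^{(m)}`, `m` odd square-free, from CORE(`E`) (`m ≡ 1 (4)`) or CORE(`E^{(−1)}`) (`m ≡ 3 (4)`:
`E^{(m)} = (E^{(−1)})^{(−m)}`), both bases having good reduction at every odd prime. [cite: SilvermanAEC2009, X.2 Exercise 10.16 and X.5 Cor. 5.4.1] -/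
theorem core_quadraticTwist_of_odd (hj : E.j ∈ maximalCMJInvariants) (hK : IsCMFieldOfJ K E.j)
    (hgoodE : ∀ (p : ℕ) [Fact p.Prime], p ≠ 2 → E.HasGoodReductionAtPrime p)
    (hgoodE' : ∀ (p : ℕ) [Fact p.Prime], p ≠ 2 → (E.quadraticTwist (-1 : ℚ)).HasGoodReductionAtPrime p)
    (hcore : ∃ ψ : HeckeCharacter K, ψ.HasInfinityType (fun _ ↦ 1) (fun _ ↦ 0) ∧
      ∀ s : ℂ, 3 / 2 < s.re → heckeLFunction ψ s = E.LSeries s)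
    (hcore' : ∃ ψ : HeckeCharacter K, ψ.HasInfinityType (fun _ ↦ 1) (fun _ ↦ 0) ∧
      ∀ s : ℂ, 3 / 2 < s.re → heckeLFunction ψ s = (E.quadraticTwist (-1 : ℚ)).LSeries s)
    {m : ℤ} (hm : m ≠ 0) (hsq : Squarefree m) (hodd : ¬ (2 : ℤ) ∣ m) :
    ∃ ψ : HeckeCharacter K, ψ.HasInfinityType (fun _ ↦ 1) (fun _ ↦ 0) ∧
      ∀ s : ℂ, 3 / 2 < s.re → heckeLFunction ψ s = (E.quadraticTwist (m : ℚ)).LSeries s := by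
  have hmq : (m : ℚ) ≠ 0 := by exact_mod_cast hm
  haveI := E.isElliptic_quadraticTwist hmq
  haveI hE1 : (E.quadraticTwist (-1 : ℚ)).IsElliptic := E.isElliptic_quadraticTwist (by norm_num)
  -- odd primes dividing `±m` are good for both bases
  have hgood1 : ∀ (p : ℕ) [Fact p.Prime], (p : ℤ) ∣ m → E.HasGoodReductionAtPrime p := by
    intro p hp hpm
    exact hgoodE p (by rintro rfl; exact hodd (by exact_mod_cast hpm))
  have hgood2 : ∀ (p : ℕ) [Fact p.Prime], (p : ℤ) ∣ -m → (E.quadraticTwist (-1 : ℚ)).HasGoodReductionAtPrime p := by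
    intro p hp hpm
    exact hgoodE' p (by rintro rfl; exact hodd (by exact_mod_cast (dvd_neg.mp hpm)))
  have hm4 : m % 4 = 1 ∨ m % 4 = 3 := by
    have h2 : m % 2 = 1 := by omega
    omega
  rcases hm4 with h1 | h3
  · by_cases hm1 : m = 1
    · subst hm1
      obtain ⟨C, hC⟩ := E.exists_variableChange_quadraticTwist_one
      refine core_of_LSeries_eq ?_ hcore
      rw [Int.cast_one, ← hC, WeierstrassCurve.LSeries_smul]
    · exact core_quadraticTwist_of_core' E hj hK hcore (Or.inl ⟨h1, hsq, hm1⟩) hgood1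
  · -- `m ≡ 3 (4)`: go through `E^{(−1)}`
    have h1' : (-m) % 4 = 1 := by omega
    have hsq' : Squarefree (-m) := fun x hx ↦ hsq x (dvd_neg.mp hx)
    have hj' : (E.quadraticTwist (-1 : ℚ)).j = E.j := E.j_quadraticTwist (by norm_num)
    have key : (E.quadraticTwist (-1 : ℚ)).quadraticTwist ((-m : ℤ) : ℚ) = E.quadraticTwist (m : ℚ) := by
      rw [quadraticTwist_quadraticTwist]; congr 1; push_cast; ring
    by_cases hm1 : -m = 1
    · have : m = -1 := by omega
      subst this
      refine core_of_LSeries_eq ?_ hcore'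
      push_cast; rfl
    · haveI : ((E.quadraticTwist (-1 : ℚ)).quadraticTwist ((-m : ℤ) : ℚ)).IsElliptic := by rw [key]; infer_instance
      have h := core_quadraticTwist_of_core' (E.quadraticTwist (-1 : ℚ)) (by rw [hj']; exact hj) (by rw [hj']; exact hK) hcore'
        (Or.inl ⟨h1', hsq', hm1⟩) hgood2
      rwa [key] at h

/-- **The row `d_K = −8` (`j = 8000`) from the pair of bases `E`, `E^{(−1)}`.** Let `E/ℚ` be elliptic with `E.j ∈ maximalCMJInvariants`,
`E.j ≠ 0, 1728`, `cmFieldDiscr E.j = −8`, with `E` and `E^{(−1)}` of good reduction at every odd prime, and suppose the core holds for `E` and for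
`E^{(−1)}`. Then it holds for EVERY elliptic `W` with `W.j = E.j`: `W ≅ E^{(d)}`, `d` square-free; `d` odd is `core_quadraticTwist_of_odd`;
`d = 2m`: `E^{(2m)} = (E^{(−2)})^{(−m)} ∼ E^{(−m)}` via `E ∼ E^{(−8)} ≅ E^{(−2)}`. [cite: SilvermanAEC2009, X.5 Cor. 5.4.1] [cite: SilvermanATAEC1994, Ch. II Thm. 10.5 (b)]
[cite: Knapp1992, Thm. 11.67] -/
theorem core_of_j_eq_of_core_pair_two (hj : E.j ∈ maximalCMJInvariants) (h0 : E.j ≠ 0) (h1728 : E.j ≠ 1728)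
    (hK : IsCMFieldOfJ K E.j) (hdisc : cmFieldDiscr E.j = -8)
    (hgoodE : ∀ (p : ℕ) [Fact p.Prime], p ≠ 2 → E.HasGoodReductionAtPrime p)
    (hgoodE' : ∀ (p : ℕ) [Fact p.Prime], p ≠ 2 → (E.quadraticTwist (-1 : ℚ)).HasGoodReductionAtPrime p)
    (hcore : ∃ ψ : HeckeCharacter K, ψ.HasInfinityType (fun _ ↦ 1) (fun _ ↦ 0) ∧
      ∀ s : ℂ, 3 / 2 < s.re → heckeLFunction ψ s = E.LSeries s)
    (hcore' : ∃ ψ : HeckeCharacter K, ψ.HasInfinityType (fun _ ↦ 1) (fun _ ↦ 0) ∧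
      ∀ s : ℂ, 3 / 2 < s.re → heckeLFunction ψ s = (E.quadraticTwist (-1 : ℚ)).LSeries s)
    (W : WeierstrassCurve ℚ) [W.IsElliptic] (hjW : W.j = E.j) :
    ∃ ψ : HeckeCharacter K, ψ.HasInfinityType (fun _ ↦ 1) (fun _ ↦ 0) ∧
      ∀ s : ℂ, 3 / 2 < s.re → heckeLFunction ψ s = W.LSeries s := by
  obtain ⟨d, hd, hsq, C, hC⟩ := exists_variableChange_eq_quadraticTwist_intCast_of_j_eq (W := W) (E := E) hjW h0 h1728
  have hdq : (d : ℚ) ≠ 0 := by exact_mod_cast hd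
  haveI := E.isElliptic_quadraticTwist hdq
  suffices h : ∃ ψ : HeckeCharacter K, ψ.HasInfinityType (fun _ ↦ 1) (fun _ ↦ 0) ∧
      ∀ s : ℂ, 3 / 2 < s.re → heckeLFunction ψ s = (E.quadraticTwist (d : ℚ)).LSeries s by
    refine core_of_LSeries_eq ?_ h
    rw [← hC, WeierstrassCurve.LSeries_smul]
  by_cases h2d : (2 : ℤ) ∣ d
  · -- even `d = 2 m₁ = (−2)(−m₁)`, `m₁` odd
    obtain ⟨m₁, rfl⟩ := h2d
    have hm₁ : m₁ ≠ 0 := by rintro rfl; exact hd (by ring)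
    have hoddm : ¬ (2 : ℤ) ∣ -m₁ := by
      rintro ⟨t, ht⟩
      have : (2 : ℤ) * 2 ∣ 2 * m₁ := ⟨-t, by linear_combination (-2 : ℤ) * ht⟩
      have hu := Int.isUnit_iff.mp (hsq 2 this)
      omega
    have hsqm : Squarefree (-m₁) := fun x hx ↦ hsq x (dvd_mul_of_dvd_right (dvd_neg.mp hx) 2)
    have hcm := core_quadraticTwist_of_odd E hj hK hgoodE hgoodE' hcore hcore' (neg_ne_zero.mpr hm₁) hsqm hoddm
    -- `E^{(−2)} ≅ E^{(−8)} ∼ E`, twisted by `−m₁`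
    have hiso := isIsogenous_quadraticTwist_cmFieldDiscr_holds E hj
    rw [hdisc] at hiso
    obtain ⟨C₂, hC₂⟩ := E.exists_variableChange_quadraticTwist_mul_sq (-2 : ℚ) 2 two_ne_zero
    have h8 : (-2 : ℚ) * 2 ^ 2 = ((-8 : ℤ) : ℚ) := by norm_num
    rw [h8] at hC₂
    haveI : (E.quadraticTwist ((-8 : ℤ) : ℚ)).IsElliptic := E.isElliptic_quadraticTwist (by norm_num)
    haveI hE2 : (E.quadraticTwist (-2 : ℚ)).IsElliptic := E.isElliptic_quadraticTwist (by norm_num)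
    have hiso2 : IsIsogenous E (E.quadraticTwist (-2 : ℚ)) :=
      hiso.trans' (by rw [← hC₂]; exact isIsogenous_of_smul (E.quadraticTwist (-2 : ℚ)) C₂)
    have hmq : ((-m₁ : ℤ) : ℚ) ≠ 0 := by exact_mod_cast (neg_ne_zero.mpr hm₁)
    haveI := E.isElliptic_quadraticTwist hmq
    haveI : ((E.quadraticTwist (-2 : ℚ)).quadraticTwist ((-m₁ : ℤ) : ℚ)).IsElliptic := (E.quadraticTwist (-2 : ℚ)).isElliptic_quadraticTwist hmq
    have hiso' := hiso2.quadraticTwist hmq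
    have key : (E.quadraticTwist (-2 : ℚ)).quadraticTwist ((-m₁ : ℤ) : ℚ) = E.quadraticTwist ((2 * m₁ : ℤ) : ℚ) := by
      rw [quadraticTwist_quadraticTwist]; congr 1; push_cast; ring
    rw [key] at hiso'
    have hL := LFunction_eq_of_isIsogenous_holds _ _ hiso'
    refine core_of_LSeries_eq ?_ hcm
    funext s
    simp only [WeierstrassCurve.LSeries, hL]
  · exact core_quadraticTwist_of_odd E hj hK hgoodE hgoodE' hcore hcore' hd hsq h2d

end Two

end Summit.BirchSwinnertonDyer.BirchSwinnertonDyer.Theorems.BiquadraticEisensteinDescentDeuringOfCore
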